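import Summits.BirchSwinnertonDyer.Rank1Residual.Additive.X3BranchLayerTwoFieldDegree
import Summits.BirchSwinnertonDyer.Rank1Residual.Additive.X3BranchZeta9CubicResidues
import HarnessLib

/-!
# X3, the DEGENERATE rows OFF the sub-locus, LAYER TWO: independence of layer-two units modulo cubes,
# certified by CUBIC RESIDUES in `ℤ[θ₂]`, `θ₂ = ζ₂₇ + ζ₂₇⁻¹` (cell `bsd-eis`, seat `bsd-eis-x3` gen 8;
# the layer-`2` analogue of gen 7's `KummerLayerClasses.eq_zero_of_cube_eq_prod_layerOne`
# (`X3BranchLayerOneCubicResidues.lean`), with the `N`-node Vandermonde step of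
# `X3BranchZeta9CubicResidues.lean` at `N = 9` and the field lemmas of `X3BranchLayerTwoFieldDegree.lean`;
# x3-MEMO-10 §5 (e); route K1 `AdditiveBranchIMC`, crux `GordTwoRankZeroOffCaseOne` — supports only)

HONEST FRAMING (`run/shared/lean/pub/bsd-eis/README.md` §4): THEOREMS ONLY (no `def`, no named fact,
no `sorry`); nothing is booked; no label, tier or count of record moves.

* `eq_zero_of_cube_eq_prod_layerTwo` — `θ₂ = ζ + ζ²⁶` (`ζ` a primitive `27`-th root of unity);
  `aᵢ = Σ_{k<9} P_{ik} θ₂^k` (`P ∈ ℤ^{ι×9}`); `γ ∈ ℚ̄` fixed by `κ⁻¹(9ℤ₃)` with `γ³ = ∏ aᵢ^{dᵢ}`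
  (`d ∈ 𝔽₃^ι`); CERTIFICATE: primes `q_ρ ≡ 1 (mod 3)` with the nine roots `r_{ρ,0..8}` of
  `f₉ = X⁹ − 9X⁷ + 27X⁵ − 30X³ + 9X + 1 (mod q_ρ)` and a `9×9` Vandermonde inverse `w_ρ`, `ω_ρ` of order
  `3`, exponents `aᵢ(r_{ρ,0})^{(q_ρ−1)/3} = ω_ρ^{e_{ρ,i}}` (`aᵢ(r_{ρ,0}) ≠ 0`), a left inverse `L` of `e`
  modulo `3`. THEN `d = 0`: minimal denominator `mγ = G(θ₂) ∈ ℤ[θ₂]`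
  (`LayerTwoField.exists_intCombination9_of_fixed`), `m³∏aᵢ^{dᵢ} ≡ G³ (mod f₉)` transferred to `𝔽_q`
  at every root (`LayerTwoField.eval₂_eq_of_aeval_eq_theta27`), `q ∤ m` by Vandermonde + minimality,
  then Fermat (`KummerLayerClasses.pow_div_three_eq_one`).
References: [IrelandRosen1990] Ch. 9 §1 (cubic residue character); [Washington1997] §13.1.
-/

set_option autoImplicit false

noncomputable section

open scoped Classical

namespace Summit.BirchSwinnertonDyer.Rank1Residual.Additive

namespace LayerTwoField

open Field Polynomial Finset
open Literature.NumberTheory.GaloisRepresentations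
open Literature.NumberTheory.EllipticCurves

/-- **Independence of layer-two units modulo cubes, by cubic residues.** See the module docstring.
[cite: IrelandRosen1990, Ch. 9 §1 (cubic residue character)] [cite: Washington1997, §13.1] -/
theorem eq_zero_of_cube_eq_prod_layerTwo {κ : ZpExtension ℚ 3} (hκ : κ.IsCyclotomic)
    {ζ : AlgebraicClosure ℚ} (hζ : IsPrimitiveRoot ζ 27) {ι : Type} [Fintype ι] [DecidableEq ι]
    (P : ι → Fin 9 → ℤ) {d : ι → ZMod 3} {γ : AlgebraicClosure ℚ}
    (hγ : γ ^ 3 = ∏ i, (∑ k : Fin 9, (P i k : AlgebraicClosure ℚ) * (ζ + ζ ^ 26) ^ (k : ℕ)) ^ (d i).val)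
    (hγG : ∀ σ ∈ κ.layerSubgroup 2, σ • γ = γ)
    {R : ℕ} (q : Fin R → ℕ) (hq : ∀ ρ, (q ρ).Prime) (hq1 : ∀ ρ, 3 ∣ q ρ - 1)
    (r : (ρ : Fin R) → Fin 9 → ZMod (q ρ))
    (hr : ∀ ρ kk, r ρ kk ^ 9 - 9 * r ρ kk ^ 7 + 27 * r ρ kk ^ 5 - 30 * r ρ kk ^ 3 + 9 * r ρ kk + 1 = 0)
    (w : (ρ : Fin R) → Fin 9 → Fin 9 → ZMod (q ρ))
    (hw : ∀ ρ (a a' : Fin 9), ∑ kk, w ρ a kk * r ρ kk ^ a'.val = if a = a' then 1 else 0)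
    (ω : (ρ : Fin R) → ZMod (q ρ)) (hω : ∀ ρ, ω ρ ^ 3 = 1 ∧ ω ρ ≠ 1)
    (e : Fin R → ι → ℕ)
    (he : ∀ ρ i, (∑ k : Fin 9, (P i k : ZMod (q ρ)) * r ρ 0 ^ (k : ℕ)) ^ ((q ρ - 1) / 3) =
      ω ρ ^ e ρ i)
    (hnz : ∀ ρ i, (∑ k : Fin 9, (P i k : ZMod (q ρ)) * r ρ 0 ^ (k : ℕ)) ≠ 0)
    (L : ι → Fin R → ℤ)
    (hL : ∀ i i', (∑ ρ, (L i ρ : ZMod 3) * (e ρ i' : ZMod 3)) = if i = i' then 1 else 0) :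
    d = 0 := by
  haveI : ∀ ρ, Fact (q ρ).Prime := fun ρ ↦ ⟨hq ρ⟩
  set θ : AlgebraicClosure ℚ := ζ + ζ ^ 26 with hθdef
  -- minimal denominator `m γ ∈ ℤ[θ₂]`
  have hex : ∃ m : ℕ, 0 < m ∧ ∃ g : Fin 9 → ℤ,
      (m : AlgebraicClosure ℚ) * γ = ∑ k : Fin 9, (g k : AlgebraicClosure ℚ) * θ ^ (k : ℕ) := by
    obtain ⟨m, g, hm, h⟩ := exists_intCombination9_of_fixed hκ hζ hγG
    exact ⟨m, hm, g, h⟩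
  set m := Nat.find hex with hmdef
  obtain ⟨hm0, g, hmγ⟩ := Nat.find_spec hex
  rw [← hmdef] at hm0 hmγ
  have hmin : ∀ m' : ℕ, m' < m → ¬ (0 < m' ∧ ∃ g : Fin 9 → ℤ,
      (m' : AlgebraicClosure ℚ) * γ = ∑ k : Fin 9, (g k : AlgebraicClosure ℚ) * θ ^ (k : ℕ)) :=
    fun m' hm' ↦ Nat.find_min hex hm'
  -- the polynomial identity `m³ ∏ Pᵢ^{dᵢ} ≡ G³` through `θ₂`
  set Pp : ι → ℤ[X] := fun i ↦ ∑ k : Fin 9, C (P i k) * X ^ (k : ℕ) with hPp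
  set Gp : ℤ[X] := ∑ k : Fin 9, C (g k) * X ^ (k : ℕ) with hGp
  have haevalP : ∀ i, aeval θ (Pp i) = ∑ k : Fin 9, (P i k : AlgebraicClosure ℚ) * θ ^ (k : ℕ) :=
    fun i ↦ by
    simp only [hPp, map_sum, map_mul, map_pow, aeval_C, aeval_X]
    simp only [eq_intCast]
  have haevalG : aeval θ Gp = (m : AlgebraicClosure ℚ) * γ := by
    rw [hmγ]
    simp only [hGp, map_sum, map_mul, map_pow, aeval_C, aeval_X]
    simp only [eq_intCast]
  have hident : aeval θ (((m : ℕ) : ℤ[X]) ^ 3 * ∏ i, Pp i ^ (d i).val) = aeval θ (Gp ^ 3) := by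
    rw [map_mul, map_pow, map_natCast, map_prod, map_pow, haevalG]
    simp_rw [map_pow, haevalP]
    rw [← hγ]; ring
  -- transfer to `𝔽_q` at a root `r`
  have htransfer : ∀ ρ (kk : Fin 9), ((m : ZMod (q ρ))) ^ 3 *
      ∏ i, (∑ k : Fin 9, (P i k : ZMod (q ρ)) * r ρ kk ^ (k : ℕ)) ^ (d i).val =
      (∑ k : Fin 9, (g k : ZMod (q ρ)) * r ρ kk ^ (k : ℕ)) ^ 3 := by
    intro ρ kk
    have e := eval₂_eq_of_aeval_eq_theta27 hκ hζ hident (r ρ kk) (hr ρ kk)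
    simp only [eval₂_mul, eval₂_finsetProd, eval₂_pow, eval₂_natCast, hPp, hGp, eval₂_finsetSum,
      eval₂_C, eval₂_X] at e
    simp only [eq_intCast] at e
    exact e
  -- `q ∤ m`
  have hqm : ∀ ρ, ((m : ZMod (q ρ))) ≠ 0 := by
    intro ρ hm0'
    -- `G(r_kk) = 0` at the nine roots
    have hG0 : ∀ kk : Fin 9, (∑ k : Fin 9, (g k : ZMod (q ρ)) * r ρ kk ^ (k : ℕ)) = 0 := by
      intro kk
      have e := htransfer ρ kk
      rw [hm0', zero_pow three_ne_zero, zero_mul] at e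
      exact pow_eq_zero_iff three_ne_zero |>.mp e.symm
    -- Vandermonde ⟹ `q ∣ g_k`
    have hg : ∀ a : Fin 9, ((g a : ZMod (q ρ))) = 0 :=
      KummerLayerTwisted.coeffs_eq_zero_of_vandermondeN (r ρ) (w ρ) (hw ρ)
        (fun a ↦ (g a : ZMod (q ρ))) hG0
    have hdvd : ∀ a : Fin 9, (q ρ : ℤ) ∣ g a := fun a ↦
      (ZMod.intCast_zmod_eq_zero_iff_dvd _ _).mp (hg a)
    have hdvdm : (q ρ : ℕ) ∣ m := (ZMod.natCast_eq_zero_iff _ _).mp hm0'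
    choose g' hg' using hdvd
    obtain ⟨m', hm'⟩ := hdvdm
    have hqpos : 0 < q ρ := (hq ρ).pos
    have hm'pos : 0 < m' := by
      rcases Nat.eq_zero_or_pos m' with h | h
      · rw [h, mul_zero] at hm'; omega
      · exact h
    have hm'lt : m' < m := by
      have : 2 ≤ q ρ := (hq ρ).two_le
      nlinarith
    refine hmin m' hm'lt ⟨hm'pos, g', ?_⟩
    have hqne : ((q ρ : ℕ) : AlgebraicClosure ℚ) ≠ 0 := by exact_mod_cast (hq ρ).ne_zero
    apply mul_left_cancel₀ hqne
    rw [Finset.mul_sum, ← mul_assoc, ← Nat.cast_mul, ← hm', hmγ]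
    refine Finset.sum_congr rfl fun k _ ↦ ?_
    rw [hg' k]; push_cast; ring
  -- cubic residues: `Σ_i e_{ρ,i} d_i ≡ 0 (mod 3)`
  have hrel3 : ∀ ρ, (∑ i, (e ρ i : ZMod 3) * d i) = 0 := by
    intro ρ
    set x : ZMod (q ρ) := ∏ i, (∑ k : Fin 9, (P i k : ZMod (q ρ)) * r ρ 0 ^ (k : ℕ)) ^ (d i).val
      with hx
    have hx0 : x ≠ 0 := Finset.prod_ne_zero_iff.mpr fun i _ ↦ pow_ne_zero _ (hnz ρ i)
    have h1 : x ^ ((q ρ - 1) / 3) = 1 :=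
      KummerLayerClasses.pow_div_three_eq_one (hq1 ρ) (hqm ρ) hx0 (htransfer ρ 0)
    have h2 : x ^ ((q ρ - 1) / 3) = ω ρ ^ (∑ i, e ρ i * (d i).val) := by
      rw [hx, ← Finset.prod_pow, ← Finset.prod_pow_eq_pow_sum]
      refine Finset.prod_congr rfl fun i _ ↦ ?_
      rw [← pow_mul, Nat.mul_comm ((d i).val) ((q ρ - 1) / 3), pow_mul, he ρ i, ← pow_mul]
    rw [h2] at h1
    have h3 : 3 ∣ ∑ i, e ρ i * (d i).val :=
      KummerLayerClasses.three_dvd_of_pow_eq_one (hω ρ).1 (hω ρ).2 h1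
    have h4 : ((∑ i, e ρ i * (d i).val : ℕ) : ZMod 3) = 0 := (ZMod.natCast_eq_zero_iff _ _).mpr h3
    push_cast at h4
    simpa only [ZMod.natCast_val, ZMod.cast_id', id_eq] using h4
  -- the left inverse finishes
  funext i
  calc d i = ∑ i', (if i = i' then 1 else 0) * d i' := by simp
    _ = ∑ i', (∑ ρ, (L i ρ : ZMod 3) * (e ρ i' : ZMod 3)) * d i' := by simp_rw [hL]
    _ = ∑ ρ, (L i ρ : ZMod 3) * ∑ i', (e ρ i' : ZMod 3) * d i' := by
        simp_rw [Finset.mul_sum, Finset.sum_mul]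
        rw [Finset.sum_comm]
        exact Finset.sum_congr rfl fun ρ _ ↦ Finset.sum_congr rfl fun i' _ ↦ by ring
    _ = 0 := by simp [hrel3]

end LayerTwoField

end Summit.BirchSwinnertonDyer.Rank1Residual.Additive

end
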